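import Literature.Computability.Complexity.GateEliminationDimension

/-!
# Gate elimination: the output gate is not fed by two variables (dimension budget for two coordinates)

A corner of the case analysis of Li–Yang's Theorem 4.1 (ECCC TR21-023, §4.1) that the printed
text passes over: between Case 5 and Case 6 the paper states "from now on, no ∧-type gate is
directly fed by two variables", which follows from Cases 3–5 for gates of out-degree `≥ 1`; an
∧-type *output* gate of out-degree `0` fed by a `3`-variable and another variable is not covered
by Cases 3 (`3 + 0 < 4`), 4, 5. Such a configuration is impossible for the same reason the
output is never trivialized ("the function is not trivial after performing these
substitutions"): on an rdq-source of dimension `D ≥ 2d + 3` with `q ≤ D/2` quadratic equations,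
an affine disperser for dimension `d` is not a function of two coordinates, since fixing two
coordinates inside the affine subspace of Prop. 2.4 leaves dimension `≥ D - q - 2 ≥ d`.
Everything is PROVED.

* `IsAffineDisperser.exists_ne_of_sol_coord_pair` — two solutions agreeing at `x_{j₁}`, `x_{j₂}`
  with different values of `f`, when `2d + 3 ≤ dim R`.
* `Semicircuit.out_ne_of_var_var` — hence the output of a fair semicircuit computing `f|_R` is
  not a gate both of whose wires are variables (whatever its function).

## References

* J. Li, T. Yang, *3.1n − o(n) circuit lower bounds for explicit functions*, STOC 2022
  [LiYang2022]; full version ECCC TR21-023, Prop. 2.3/2.4, §4.1 (between Cases 5 and 6).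
-/

namespace Literature.Computability.Complexity

open Finset Module

/-- **An affine disperser for dimension `d` is not a function of two coordinates on an rdq-source
of dimension `≥ 2d + 3`**: there are two solutions agreeing at `x_{j₁}` and `x_{j₂}` with
different values (inside the affine subspace of Prop. 2.4, of dimension `≥ D - q ≥ d + 2`, fix the
two coordinates one after the other). [cite: LiYang2022, Prop. 2.4] -/
theorem IsAffineDisperser.exists_ne_of_sol_coord_pair {n d : ℕ} {f : (Fin n → ZMod 2) → Bool}
    (hf : IsAffineDisperser f d) (R : RdqSource n) (hd : 2 * d + 3 ≤ R.dim) (j₁ j₂ : Fin n) :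
    ∃ u ∈ R.Sol, ∃ v ∈ R.Sol, u j₁ = v j₁ ∧ u j₂ = v j₂ ∧ f u ≠ f v := by
  obtain ⟨A, hA, hne, hdim, hq⟩ := R.exists_affineSubspace_subset_sol
  obtain ⟨A', hA', hne', hdim', hconst'⟩ := exists_le_coord_const A hne j₁
  obtain ⟨A'', hA'', hne'', hdim'', hconst''⟩ := exists_le_coord_const A' hne' j₂
  obtain ⟨u, hu, v, hv, huv⟩ := hf A'' (by omega) hne''
  exact ⟨u, hA (hA' (hA'' hu)), v, hA (hA' (hA'' hv)), hconst' u (hA'' hu) v (hA'' hv),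
    hconst'' u hu v hv, huv⟩

namespace Semicircuit

variable {n : ℕ} {C : Semicircuit n} {f : (Fin n → ZMod 2) → Bool} {R : RdqSource n} {d : ℕ}

/-- **The output gate is not fed by two variables** (dimension `≥ 2d + 3`): its value would be a
function of two coordinates of the input on `Sol R`. In particular an ∧-type gate fed by two
variables is never the output in the situation of the one-step claim, so it has out-degree `≥ 1`
in a pre-normalized circuit and falls under Cases 3–5 of §4.1. [cite: LiYang2022, §4.1 (Cases 3–5)] -/
theorem out_ne_of_var_var (hf : IsAffineDisperser f d) (hd : 2 * d + 3 ≤ R.dim) (hF : C.Fair)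
    (hC : C.ComputesRestr f R) {k₀ : Fin C.m} {j₁ j₂ : Fin n}
    (h₀ : C.arg k₀ 0 = .var j₁) (h₁ : C.arg k₀ 1 = .var j₂) : C.out ≠ .gate k₀ := by
  intro hout
  obtain ⟨u, hu, v, hv, hj₁, hj₂, huv⟩ := hf.exists_ne_of_sol_coord_pair R hd j₁ j₂
  have key : ∀ u ∈ R.Sol, f u = C.op k₀ (boolOfZMod2.symm u j₁) (boolOfZMod2.symm u j₂) := by
    intro u hu
    obtain ⟨w, hw, -⟩ := hF (boolOfZMod2.symm u)
    have h1 := hC.2 u hu w hw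
    rw [hout] at h1
    have h2 := hw k₀
    rw [h₀, h₁] at h2
    rw [← h1]
    exact h2
  have e₁ : boolOfZMod2.symm u j₁ = boolOfZMod2.symm v j₁ := by
    rw [Circuit.boolOfZMod2_symm_apply, Circuit.boolOfZMod2_symm_apply, hj₁]
  have e₂ : boolOfZMod2.symm u j₂ = boolOfZMod2.symm v j₂ := by
    rw [Circuit.boolOfZMod2_symm_apply, Circuit.boolOfZMod2_symm_apply, hj₂]
  exact huv ((key u hu).trans (by rw [e₁, e₂]; exact (key v hv).symm))

/-- The same for wires at arbitrary (hence both) positions. [cite: LiYang2022, §4.1 (Cases 3–5)] -/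
theorem out_ne_of_vars (hf : IsAffineDisperser f d) (hd : 2 * d + 3 ≤ R.dim) (hF : C.Fair)
    (hC : C.ComputesRestr f R) {k₀ : Fin C.m} (h : ∀ a, ∃ j, C.arg k₀ a = .var j) : C.out ≠ .gate k₀ := by
  obtain ⟨j₁, h₀⟩ := h 0
  obtain ⟨j₂, h₁⟩ := h 1
  exact out_ne_of_var_var hf hd hF hC h₀ h₁

/-- Hence, in a circuit whose only `0`-gate is the output (pre-normalized), **a gate fed by two
variables has a reader**. [cite: LiYang2022, §4.1 (Cases 3–5)] -/
theorem fanout_pos_of_var_var (hf : IsAffineDisperser f d) (hd : 2 * d + 3 ≤ R.dim) (hF : C.Fair)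
    (hC : C.ComputesRestr f R) (hN : ∀ k, C.fanout (.gate k) = 0 → C.out = .gate k)
    {k₀ : Fin C.m} {j₁ j₂ : Fin n} (h₀ : C.arg k₀ 0 = .var j₁) (h₁ : C.arg k₀ 1 = .var j₂) :
    0 < C.fanout (.gate k₀) := by
  by_contra h0
  push Not at h0
  exact out_ne_of_var_var hf hd hF hC h₀ h₁ (hN k₀ (Nat.le_zero.mp h0))

end Semicircuit

end Literature.Computability.Complexity
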